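import Summits.Ventures.WeilGRH.DualTrigKernelPartial
import Summits.Ventures.WeilGRH.UniformConductorFloor
import HarnessLib

/-!
# Universal rungs from an archimedean-only D-K certificate with the SLIVER prime budget

Cell `rh-explicit`, WEIL TRACK — GRH ARM, route B (weil-grh-3, gen4), combining two landed pieces:

* the ARCHIMEDEAN-ONLY format-D-K certificate (`DualTrigKernelPartial.lean`): a kernel-checked `c : DKCert`
  with the empty window (`c.N = 1`, `c.vals = []`) certifies, for every real `τ`,
  `0 ≤ Re ψ(1/4 + a/2 + iτ/2) + log c.q − log π + T(τ)` with atoms `T` annihilated by every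
  `|ĝ(1/2+iτ)|²`, `g ∈ C_c^∞[−t, t]`, once `k ω ≥ 2t` — hence the archimedean integral obeys
  `(1/2π) ∫ |ĝ(1/2+iτ)|² Re ψ(1/4 + a/2 + iτ/2) dτ ≥ (log π − log c.q) ‖g‖₂²`
  (`DKCert.arch_integral_ge_of_check`), which is what the LP value `ℓ_a(t) ≈ −log c.q` measures;
* the SLIVER prime budget of `UniformConductorFloor.lean` (weil-grh-1, `UniformFloor.norm_weilPrimeTermChar_le`):
  position side, `|k(log n)| ≤ ‖g‖₂²`, and `2|k(log n)| ≤ ‖g‖₂²` as soon as `t ≤ log n` (the two slivers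
  `[log n − t, t]`, `[−t, t − log n]` are disjoint), so `|P_χ(k)| ≤ 2‖g‖₂² Σ_{n ≤ N} (Λ(n)/√n) c_n` with
  `c_n = 1/2` for `log n ≥ t`, else `1`, for EVERY character.

**THEOREM** (`DKCert.weilPositivityOnChar_universal_sliver_of_check`).  If `c.check = true`, `c.N = 1`,
`c.vals = []`, `e^{2t} ≤ N' + 1`, every atom has `p₀^k ≥ (N'+1)^D`, and
`log c.q + 2 Σ_{n ≤ N'} (Λ(n)/√n) c_n ≤ log q`, then `WeilPositivityOnChar χ t` for EVERY Dirichlet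
character `χ` mod `q ≠ 1` of parity `c.par`.  Compared with `weilPositivityOnChar_universal_of_check` the
prime budget is halved on `log n ≥ t` (at `t = (log 8)/2`: `B = 5.8527 → 3.4165`; at `(log 5)/2`:
`2.9421 → 1.9612`); compared with `UniformFloor.weilPositivityOnChar_of_budget` the archimedean budget
`log π − ψ(x) − Σ(1/l − 2t)` is replaced by the certificate's `log c.q` (at `t ≈ 1`, even: `3.37 → log 18
= 2.89`; odd: `2.23 → log 7 = 1.95`).  Everything here is PROVED; no named facts, no `sorry`.

## References

* A. Weil, *Sur les "formules explicites" de la théorie des nombres premiers* (1952), (11) pp. 261–262 and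
  the «lemme» p. 262 [Weil1952FormulesExplicites]; H. Yoshida (1992), §2 (2.1) [Yoshida1992].
-/

noncomputable section

open Complex Set MeasureTheory Finset Real
open scoped ComplexConjugate

namespace Summit.Ventures.WeilGRH

open Literature.Analysis.ValidatedNumerics.NumericsMP
open Literature.NumberTheory.LFunctions
open scoped ArithmeticFunction.vonMangoldt

/-! ### The sliver prime budget with a coprimality pattern -/

section primes

variable {q : ℕ} {g : ℝ → ℂ}

/-- **PRIME BOUND with weights and the coprimality pattern** (variant of
`UniformFloor.norm_weilPrimeTermChar_le`): for `k = g ⋆ g̃`, `tsupport g ⊆ [-t, t]`, `e^{2t} ≤ N + 1` and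
weights `c_n ≥ 0` such that, for each `n ≤ N`, either `χ(n) = 0` (e.g. `(n, q) > 1`), or `c_n ≥ 1`, or
`c_n ≥ 1/2` together with `t ≤ log n` (SLIVER case `2|k(log n)| ≤ ‖g‖₂²`):
`|P_χ(k)| ≤ 2‖g‖₂² Σ_{n ≤ N} (Λ(n)/√n) c_n`. [cite: Weil1952FormulesExplicites, (11) pp. 261–262 (prime term); Yoshida1992, §2] -/
theorem norm_weilPrimeTermChar_le_of_weights (χ : DirichletCharacter ℂ q) (hg : IsWeilTest g) {t : ℝ}
    (hsupp : tsupport g ⊆ Icc (-t) t) {N : ℕ} (hN : Real.exp (2 * t) ≤ (N : ℝ) + 1)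
    (c : ℕ → ℝ) (hc : ∀ n ∈ Finset.range (N + 1), 0 ≤ c n ∧
      (χ (n : ZMod q) = 0 ∨ 1 ≤ c n ∨ (1 / 2 ≤ c n ∧ t ≤ Real.log n))) :
    ‖weilPrimeTermChar χ (weilConv g (weilReflect g))‖ ≤
      2 * weilNorm2Sq g * ∑ n ∈ Finset.range (N + 1), (Λ n : ℝ) / Real.sqrt n * c n := by
  set k := weilConv g (weilReflect g) with hk
  set N2 := weilNorm2Sq g with hN2
  have hN20 : 0 ≤ N2 := integral_nonneg fun _ ↦ by positivity
  have hkc : Continuous k := (hg.weilConv hg.weilReflect).1.continuous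
  have hks : tsupport k ⊆ Icc (-(2 * t)) (2 * t) := tsupport_weilConv_weilReflect_subset hg.2 hsupp
  rw [weilPrimeTermChar_eq_sum_of_tsupport_subset χ hkc hN hks, Finset.mul_sum]
  refine (norm_sum_le _ _).trans (Finset.sum_le_sum fun n hn ↦ ?_)
  have hΛ : 0 ≤ (Λ n : ℝ) / Real.sqrt n :=
    div_nonneg ArithmeticFunction.vonMangoldt_nonneg (Real.sqrt_nonneg _)
  have hcoef : ‖((Λ n : ℝ) : ℂ) / (Real.sqrt n : ℂ)‖ = (Λ n : ℝ) / Real.sqrt n := by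
    rw [← Complex.ofReal_div, Complex.norm_real, Real.norm_of_nonneg hΛ]
  have hχ : ‖χ (n : ZMod q)‖ ≤ 1 := DirichletCharacter.norm_le_one χ _
  have hneg : ‖k (-Real.log n)‖ = ‖k (Real.log n)‖ := by
    rw [hk, weilConv_weilReflect_neg, Complex.norm_conj]
  obtain ⟨hc0, hcase⟩ := hc n hn
  have hin : ‖χ (n : ZMod q) * k (Real.log n) + conj (χ (n : ZMod q)) * k (-Real.log n)‖ ≤
      2 * c n * N2 := by
    rcases hcase with hz | hrest
    · rw [hz, map_zero, zero_mul, zero_mul, add_zero, norm_zero]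
      positivity
    · have hkey : 2 * ‖k (Real.log n)‖ ≤ 2 * c n * N2 := by
        rcases hrest with h1 | ⟨h2, htn⟩
        · have hb : ‖k (Real.log n)‖ ≤ N2 := norm_weilConv_weilReflect_le hg (Real.log n)
          nlinarith
        · rcases le_or_gt (Real.log n) (2 * t) with hle | hlt
          · have hb : 2 * ‖k (Real.log n)‖ ≤ N2 := two_mul_norm_weilConv_weilReflect_le hg hsupp htn hle
            nlinarith
          · have h0 : k (Real.log n) = 0 :=
              weilConv_weilReflect_eq_zero_of_le_abs hg hsupp
                (by rw [abs_of_nonneg (Real.log_natCast_nonneg n)]; exact hlt.le)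
            rw [h0, norm_zero, mul_zero]
            positivity
      refine (norm_add_le _ _).trans ?_
      rw [norm_mul, norm_mul, Complex.norm_conj, hneg]
      have hk0 : 0 ≤ ‖k (Real.log n)‖ := norm_nonneg _
      nlinarith [mul_le_mul_of_nonneg_right hχ hk0]
  rw [norm_mul, hcoef]
  calc (Λ n : ℝ) / Real.sqrt n *
        ‖χ (n : ZMod q) * k (Real.log n) + conj (χ (n : ZMod q)) * k (-Real.log n)‖
      ≤ (Λ n : ℝ) / Real.sqrt n * (2 * c n * N2) := mul_le_mul_of_nonneg_left hin hΛ
    _ = 2 * N2 * ((Λ n : ℝ) / Real.sqrt n * c n) := by ring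

end primes

namespace DKCert

variable {c : DKCert} {q : ℕ} {g : ℝ → ℂ}

/-- **The archimedean inequality of an archimedean-only certificate**, pointwise: if `c.check = true` with
the empty window, then for every character `χ` of parity `c.par` (any modulus) and every real `τ`,
`log π − log c.q ≤ Re ψ(1/4 + a_χ/2 + iτ/2) + T(τ)`. [folklore] -/
theorem arch_pointwise_of_check (hc : c.check = true) (hN : c.N = 1) (hv : c.vals = [])
    (χ : DirichletCharacter ℂ q) (hpar : charParity χ = c.par) (τ : ℝ) :
    Real.log π - Real.log c.q ≤
      (Complex.digamma (1 / 4 + (charParity χ : ℂ) / 2 + τ / 2 * I)).re + trigSum (c.atoms.map c.atomT) τ := by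
  have h := le_sound_threshold hc χ hpar (by rw [hv]; simp) (by
    intro n hn hpp _
    exfalso
    rw [hN] at hn
    have := hpp.two_le
    omega) τ
  rw [hN] at h
  unfold weilFinitePrimeWeightChar at h
  rw [weilPrimeRippleChar_one] at h
  linarith

/-- **The archimedean integral from an archimedean-only certificate.**  For `g ∈ C_c^∞` with
`tsupport g ⊆ [−t, t]`, `e^{2t} ≤ N' + 1`, atoms admissible for `N'` (`p₀^k ≥ (N'+1)^D`), and `χ` of
parity `c.par`: `(log π − log c.q) ‖g‖₂² ≤ (1/2π) ∫ |ĝ(1/2+iτ)|² Re ψ(1/4 + c.par/2 + iτ/2) dτ`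
(the atoms integrate to `0` against `|ĝ|²`; Plancherel `∫ |ĝ|² = 2π ‖g‖₂²`). [folklore] -/
theorem arch_integral_ge_of_check (hc : c.check = true) (hN : c.N = 1) (hv : c.vals = [])
    {t : ℝ} {N' : ℕ} (hN' : Real.exp (2 * t) ≤ (N' : ℝ) + 1)
    (hadm : (c.atoms.all fun atm => decide ((N' + 1) ^ c.D ≤ c.p0 ^ atm.k)) = true)
    (χ : DirichletCharacter ℂ q) (hpar : charParity χ = c.par)
    (hg : IsWeilTest g) (hsupp : tsupport g ⊆ Icc (-t) t) :
    (Real.log π - Real.log c.q) * weilNorm2Sq g ≤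
      1 / (2 * π) * ∫ τ : ℝ, ‖weilMellin g (1 / 2 + τ * I)‖ ^ 2 *
        (digamma ((((1 / 4 + (c.par : ℝ) / 2 : ℝ)) : ℂ) + ((τ / 2 : ℝ) : ℂ) * I)).re := by
  -- constants of the certificate
  have hc' := hc
  unfold check frameOK at hc'
  simp only [Bool.and_eq_true] at hc'
  obtain ⟨⟨⟨⟨⟨⟨hconsts, _⟩, _⟩, _⟩, _⟩, _⟩, _⟩ := hc'
  obtain ⟨_, hp0, hD, -⟩ := constsOK_sound hconsts
  set W : ℝ → ℝ := fun τ ↦ ‖weilMellin g (1 / 2 + τ * I)‖ ^ 2 with hW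
  set T : ℝ → ℝ := trigSum (c.atoms.map c.atomT) with hT
  set x : ℝ := 1 / 4 + (c.par : ℝ) / 2 with hx
  have hx0 : 0 < x := by positivity
  set N2 := weilNorm2Sq g with hN2
  -- atoms are admissible for the window `t`: `2t ≤ log (N'+1) ≤ k ω`
  have h2t : 2 * t ≤ Real.log ((N' : ℝ) + 1) := by
    have h := Real.log_le_log (Real.exp_pos _) hN'
    rwa [Real.log_exp] at h
  have hxA : ∀ A ∈ c.atoms.map c.atomT, 2 * t ≤ A.x := fun A hA ↦
    h2t.trans (atoms_admissible hp0 hD hadm A hA)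
  obtain ⟨hIT, hT0⟩ := integrable_and_integral_norm_sq_weilMellin_mul_trigSum hg hsupp (c.atoms.map c.atomT) hxA
  -- integrability of the digamma part and Plancherel
  have hIψ : Integrable fun τ : ℝ ↦ W τ * (digamma ((x : ℂ) + ((τ / 2 : ℝ) : ℂ) * I)).re := by
    refine (integrable_norm_sq_weilMellin_mul_re_digamma hg hx0).congr (Filter.Eventually.of_forall fun τ ↦ ?_)
    simp only [hW, Complex.ofReal_div, Complex.ofReal_ofNat]
  have hIW : Integrable W := integrable_norm_sq_weilMellin_half_line hg
  have hP : ∫ τ : ℝ, W τ = 2 * π * N2 := integral_norm_sq_weilMellin_half_line hg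
  -- pointwise minorant
  have hpt : ∀ τ : ℝ, W τ * (Real.log π - Real.log c.q) ≤
      W τ * (digamma ((x : ℂ) + ((τ / 2 : ℝ) : ℂ) * I)).re + W τ * T τ := by
    intro τ
    have h := arch_pointwise_of_check hc hN hv χ hpar τ
    have e : (Complex.digamma (1 / 4 + (charParity χ : ℂ) / 2 + τ / 2 * I)).re =
        (digamma ((x : ℂ) + ((τ / 2 : ℝ) : ℂ) * I)).re := by
      rw [hpar, hx]
      congr 2
      push_cast
      ring
    rw [e] at h
    have hW0 : 0 ≤ W τ := by positivity
    nlinarith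
  have hint : ∫ τ : ℝ, W τ * (Real.log π - Real.log c.q) ≤
      ∫ τ : ℝ, (W τ * (digamma ((x : ℂ) + ((τ / 2 : ℝ) : ℂ) * I)).re + W τ * T τ) :=
    integral_mono (hIW.mul_const _) (hIψ.add hIT) hpt
  rw [integral_mul_const, integral_add hIψ hIT, hT0, add_zero, hP] at hint
  have hπ : 0 < 2 * π := by positivity
  rw [show 1 / (2 * π) * ∫ τ : ℝ, W τ * (digamma ((x : ℂ) + ((τ / 2 : ℝ) : ℂ) * I)).re =
      (∫ τ : ℝ, W τ * (digamma ((x : ℂ) + ((τ / 2 : ℝ) : ℂ) * I)).re) / (2 * π) by ring,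
    le_div_iff₀ hπ]
  linarith

/-- **UNIVERSAL RUNG with the SLIVER prime budget.**  If `c.check = true` with the empty window
(`c.N = 1`, `c.vals = []`), `e^{2t} ≤ N' + 1`, the atoms are admissible for `N'`, and
`log c.q + B ≤ log q` for a budget `B ≥ 2 Σ_{n ≤ N'} (Λ(n)/√n) c_n` with weights `c_n ≥ 0` that are `≥ 1`, or
`≥ 1/2` when `t ≤ log n`, or arbitrary when `χ(n) = 0` (the coprimality pattern of `q`),
then `WeilPositivityOnChar χ t` for EVERY Dirichlet character `χ` mod `q ≠ 1` of parity `c.par`: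
`Re Q_χ(g) ≥ [log q − log c.q − 2Σ(Λ(n)/√n)c_n] ‖g‖₂² ≥ 0`.  No value of `χ` enters.
[cite: Weil1952FormulesExplicites, (11) pp. 261–262 and the «lemme» p. 262; Yoshida1992, §2 (2.1)] -/
theorem weilPositivityOnChar_universal_sliver_of_check (hc : c.check = true) (hN : c.N = 1) (hv : c.vals = [])
    {t : ℝ} {N' : ℕ} (hN' : Real.exp (2 * t) ≤ (N' : ℝ) + 1)
    (hadm : (c.atoms.all fun atm => decide ((N' + 1) ^ c.D ≤ c.p0 ^ atm.k)) = true)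
    (hq1 : q ≠ 1) (χ : DirichletCharacter ℂ q) (hpar : charParity χ = c.par) {B : ℝ}
    (hbud : ∃ cw : ℕ → ℝ, (∀ n ∈ Finset.range (N' + 1), 0 ≤ cw n ∧
        (χ (n : ZMod q) = 0 ∨ 1 ≤ cw n ∨ (1 / 2 ≤ cw n ∧ t ≤ Real.log n))) ∧
      2 * ∑ n ∈ Finset.range (N' + 1), (Λ n : ℝ) / Real.sqrt n * cw n ≤ B)
    (hlog : Real.log c.q + B ≤ Real.log q) :
    WeilPositivityOnChar χ t := by
  obtain ⟨cw, hcw, hcwB⟩ := hbud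
  intro g hg hsupp
  set k := weilConv g (weilReflect g) with hk
  set N2 := weilNorm2Sq g with hN2
  have hN20 : 0 ≤ N2 := integral_nonneg fun _ ↦ by positivity
  set A : ℝ := ∫ τ : ℝ, ‖weilMellin g (1 / 2 + τ * I)‖ ^ 2 *
    (digamma ((((1 / 4 + (c.par : ℝ) / 2 : ℝ)) : ℂ) + ((τ / 2 : ℝ) : ℂ) * I)).re with hA
  set S : ℝ := ∑ n ∈ Finset.range (N' + 1), (Λ n : ℝ) / Real.sqrt n * cw n with hS
  have hre : (weilQuadraticChar χ g).re =
      -(weilPrimeTermChar χ k).re + (1 / (2 * π) * A + N2 * (Real.log q - Real.log π)) := by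
    rw [UniformFloor.weilQuadraticChar_eq_neg_prime_add hq1 χ hpar hg, Complex.add_re, Complex.neg_re,
      Complex.ofReal_re]
  have hPr : (weilPrimeTermChar χ k).re ≤ 2 * N2 * S :=
    (Complex.re_le_norm _).trans (norm_weilPrimeTermChar_le_of_weights χ hg hsupp hN' cw hcw)
  have hArch : (Real.log π - Real.log c.q) * N2 ≤ 1 / (2 * π) * A :=
    arch_integral_ge_of_check hc hN hv hN' hadm χ hpar hg hsupp
  have hSB : 2 * N2 * S ≤ N2 * B := by nlinarith
  have hBN : (Real.log c.q + B) * N2 ≤ Real.log q * N2 := mul_le_mul_of_nonneg_right hlog hN20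
  rw [hre]
  nlinarith

end DKCert

end Summit.Ventures.WeilGRH

end
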